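import Mathlib.CategoryTheory.Localization.CalculusOfFractions
import Mathlib.CategoryTheory.SingleObj
import Mathlib.Algebra.Order.Archimedean.Basic
import Mathlib.Data.NNRat.Order
import Literature.AlgebraicGeometry.Frobenioids.DivisorMonoidExamples
import HarnessLib

/-!
# Frobenioids I, §4: Example 4.3 — the self-equivalences `Ψ_λ` (PROVED) — and Remark 4.9.1
# ("the Frobenioid of Example 4.3 is not of rational type") over the birationalization

Mochizuki, *The geometry of Frobenioids I: the general theory*, Kyushu J. Math. **62** (2008)
293–400, kurims text pp. 81–82 (Ex. 4.3) and p. 90 (Rem. 4.9.1)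
[cite: MochizukiFrdI2008, Ex. 4.3 p.82, Rem. 4.9.1 p.90]. Proof-only companion of
`DivisorMonoidExamples.lean` (seat abc-iut-L1-t3; statements `Ex43.claims_psi`, `Ex43.Remark491`
untouched); abc-iut nodes `FrdI:Ex4.3`, `FrdI:Rmk4.9.1`.

* `Ex43.claims_psi_holds : claims_psi` — for every `λ ∈ ℚ_{>0}` the self-equivalence `Ψ_λ` of the
  category `C` of Ex. 4.3 ("`a ↦ a`, `-a ↦ -λ·a` for `a ∈ ℚ_{≥0}`", p. 82) is CONSTRUCTED (it is even an
  automorphism of `C`, with inverse `Ψ_{λ⁻¹}`) and the four printed clauses are proved: object map,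
  preservation of Frobenius degrees, right-hand isomorphism `= id` and left-hand isomorphism `= λ·`
  at the Frobenius-trivial object `0`.
* Rem. 4.9.1. The typed statement `Ex43.Remark491 B Supp` is a SCHEMA over a free birationalization
  datum `B : data.BiratData` (interface of Prop. 4.4, whose field `phiBirat = Φ^birat` is free data)
  and a free support predicate `Supp` (§2): its truth value depends on the binding (with
  `B.phiBirat := ⊤` and `Supp a 𝔭 := a ≠ 0` every object is strictly rational, so the schema is false;
  with `B.phiBirat := ⊥` it is trivially true) — finding R491-F1 to the typer, no kernel junk witness
  filed. What is PROVED here is the printed content for THE birationalization, characterised as in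
  the cell's ruling C5‴ (b) (`toBirat` is a localisation of `C` at the co-angular pre-steps — print:
  "`Hom_{C^birat}(A, B) := lim_{A' → A} Hom_C(A', B)` over the co-angular pre-steps `A' → A`", Prop. 4.4
  p. 82) together with the typed exactness clause Prop. 4.4 (iii) (`Φ^birat(A)` is the image of
  `O^×(A^birat)`): (1) the co-angular pre-steps of `C` (= the arrows of Frobenius degree `1`) admit a
  right calculus of fractions; (2) in ANY localisation `L : C → C[W⁻¹]` at them, an arrow of `C` that
  becomes invertible has Frobenius degree `1` (the degree functor `C → B(N_{≥1})` inverts `W`), hence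
  every automorphism of `L(A)` is the identity — "`O^×(A^birat) = {1}`"; (3) `Prime(ℚ_{≥0}) ≠ ∅`;
  hence (4) `Φ^birat ≡ 0`, no object of `C` is strictly rational, no object is rational
  (`Ex43.not_isRational`), and `Remark491 B Supp` holds for every such `B` and EVERY `Supp`
  (`Ex43.remark491_of_isLocalization`).
No statement of the paper is strengthened; nothing here bears on [IUTchIII] Cor. 3.12.
-/

namespace Literature.AlgebraicGeometry.Frobenioids

open CategoryTheory

namespace Ex43

/-! ### Elementary facts about the category `C` of Example 4.3 -/

/-- An object of `C` is determined by its rational number. [cite: MochizukiFrdI2008, Ex. 4.3 p.82] -/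
theorem Obj.eq_of_val_eq {a b : Obj} (h : a.val = b.val) : a = b := by
  cases a; cases b; cases h; rfl

/-- The arrows `eqToHom` of `C` have Frobenius degree `1`. [cite: MochizukiFrdI2008, Ex. 4.3 p.82] -/
theorem deg_eqToHom {a b : Obj} (h : a = b) : Hom.deg (eqToHom h) = 1 := by
  subst h; rfl

/-- `Ψ_λ` is the identity on `ℚ_{≥0}` (p. 82: "`a ↦ a`"). [cite: MochizukiFrdI2008, Ex. 4.3 p.82] -/
theorem psiObj_of_nonneg {l : ℚ} {a : Obj} (h : 0 ≤ a.val) : psiObj l a = a := by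
  simp [psiObj, h]

/-- `Ψ_λ` multiplies negative rationals by `λ` (p. 82: "`-a ↦ -λ·a`"). [cite: MochizukiFrdI2008, Ex. 4.3 p.82] -/
theorem psiObj_of_neg {l : ℚ} {a : Obj} (h : a.val < 0) : psiObj l a = ⟨l * a.val⟩ := by
  simp [psiObj, not_le.mpr h]

/-- Value of `Ψ_λ(a)` for `a ≥ 0`. [cite: MochizukiFrdI2008, Ex. 4.3 p.82] -/
theorem psiObj_val_of_nonneg {l : ℚ} {a : Obj} (h : 0 ≤ a.val) : (psiObj l a).val = a.val := by
  rw [psiObj_of_nonneg h]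

/-- Value of `Ψ_λ(a)` for `a < 0`. [cite: MochizukiFrdI2008, Ex. 4.3 p.82] -/
theorem psiObj_val_of_neg {l : ℚ} {a : Obj} (h : a.val < 0) : (psiObj l a).val = l * a.val := by
  rw [psiObj_of_neg h]

/-- `Ψ_λ` is compatible with the arrows of `C`: `d · a ≤ b` implies `d · Ψ_λ(a) ≤ Ψ_λ(b)` for `λ > 0`
(so `Ψ_λ` acts on morphisms keeping the Frobenius degree). [cite: MochizukiFrdI2008, Ex. 4.3 p.82] -/
theorem psiObj_le {l : ℚ} (hl : 0 < l) {a b : Obj} (φ : a ⟶ b) :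
    (Hom.deg φ : ℚ) * (psiObj l a).val ≤ (psiObj l b).val := by
  have hφ := Hom.le φ
  have hd : (0 : ℚ) < (Hom.deg φ : ℚ) := by exact_mod_cast (Hom.deg φ).pos
  by_cases ha : 0 ≤ a.val
  · have hb : 0 ≤ b.val := le_trans (mul_nonneg hd.le ha) hφ
    rw [psiObj_val_of_nonneg ha, psiObj_val_of_nonneg hb]
    exact hφ
  · rw [not_le] at ha
    rw [psiObj_val_of_neg ha]
    by_cases hb : 0 ≤ b.val
    · rw [psiObj_val_of_nonneg hb]
      have hla : l * a.val < 0 := mul_neg_of_pos_of_neg hl ha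
      exact (mul_nonpos_iff.mpr (Or.inl ⟨hd.le, hla.le⟩)).trans hb
    · rw [not_le] at hb
      rw [psiObj_val_of_neg hb]
      calc (Hom.deg φ : ℚ) * (l * a.val) = l * ((Hom.deg φ : ℚ) * a.val) := by ring
        _ ≤ l * b.val := mul_le_mul_of_nonneg_left hφ hl.le

/-- `Ψ_{λ⁻¹} ∘ Ψ_λ = id` on objects. [cite: MochizukiFrdI2008, Ex. 4.3 p.82] -/
theorem psiObj_inv_psiObj {l : ℚ} (hl : 0 < l) (a : Obj) : psiObj l⁻¹ (psiObj l a) = a := by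
  by_cases ha : 0 ≤ a.val
  · rw [psiObj_of_nonneg ha, psiObj_of_nonneg ha]
  · rw [not_le] at ha
    have h' : (⟨l * a.val⟩ : Obj).val < 0 := mul_neg_of_pos_of_neg hl ha
    rw [psiObj_of_neg ha, psiObj_of_neg h']
    exact Obj.eq_of_val_eq (by
      show l⁻¹ * (l * a.val) = a.val
      rw [← mul_assoc, inv_mul_cancel₀ hl.ne', one_mul])

/-- `Ψ_λ ∘ Ψ_{λ⁻¹} = id` on objects. [cite: MochizukiFrdI2008, Ex. 4.3 p.82] -/
theorem psiObj_psiObj_inv {l : ℚ} (hl : 0 < l) (a : Obj) : psiObj l (psiObj l⁻¹ a) = a := by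
  have h := psiObj_inv_psiObj (inv_pos.mpr hl) a
  rwa [inv_inv] at h

/-- `Ψ_λ(0) = 0`. [cite: MochizukiFrdI2008, Ex. 4.3 p.82] -/
theorem psiObj_zero (l : ℚ) : psiObj l ⟨0⟩ = ⟨0⟩ := psiObj_of_nonneg (le_refl (0 : ℚ))

/-! ### Example 4.3: the self-equivalences `Ψ_λ` with their right-hand and left-hand isomorphisms -/

/-- **Example 4.3** (PROVED; node `FrdI:Ex4.3`): for every `λ ∈ ℚ_{>0}` the assignment "`a ↦ a`,
`-a ↦ -λ·a`" (`a ∈ ℚ_{≥0}`) on objects, and the identity on Frobenius degrees on arrows, is a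
self-equivalence `Ψ_λ` of `C` (indeed an automorphism with inverse `Ψ_{λ⁻¹}`); it fixes the zero
divisors of the co-angular pre-steps out of the Frobenius-trivial object `0` (right-hand isomorphism
`= id_{ℚ_{≥0}}`) and multiplies by `λ` those of the co-angular pre-steps into `0` (left-hand
isomorphism `= λ·`), as asserted on p. 82 — discharging `claims_psi` exactly as typed.
[cite: MochizukiFrdI2008, Ex. 4.3 p.82] -/
theorem claims_psi_holds : claims_psi := by
  intro l hl
  have hl' : 0 < l⁻¹ := inv_pos.mpr hl
  -- the functor `Ψ_m` for `m > 0`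
  let Ψf : ∀ m : ℚ, 0 < m → (Obj ⥤ Obj) := fun m hm =>
    { obj := psiObj m
      map := fun φ => ⟨Hom.deg φ, psiObj_le hm φ⟩
      map_id := fun _ => hom_ext rfl
      map_comp := fun _ _ => hom_ext rfl }
  let F : Obj ⥤ Obj := Ψf l hl
  let G : Obj ⥤ Obj := Ψf l⁻¹ hl'
  have hFobj : ∀ a, F.obj a = psiObj l a := fun _ => rfl
  have hFdeg : ∀ {a b : Obj} (φ : a ⟶ b), Hom.deg (F.map φ) = Hom.deg φ := fun _ => rfl
  have hGdeg : ∀ {a b : Obj} (φ : a ⟶ b), Hom.deg (G.map φ) = Hom.deg φ := fun _ => rfl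
  have hGF : ∀ a, G.obj (F.obj a) = a := fun a => psiObj_inv_psiObj hl a
  have hFG : ∀ b, F.obj (G.obj b) = b := fun b => psiObj_psiObj_inv hl b
  -- unit and counit: `eqToIso` along the object identities; naturality = equality of degrees
  let η : 𝟭 Obj ≅ F ⋙ G := NatIso.ofComponents (fun a => eqToIso (hGF a).symm) (fun φ => hom_ext (by
    rw [comp_deg, comp_deg, Functor.id_map, Functor.comp_map, hGdeg, hFdeg, eqToIso.hom, eqToIso.hom,
      deg_eqToHom, deg_eqToHom, mul_one, one_mul]))
  let ε : G ⋙ F ≅ 𝟭 Obj := NatIso.ofComponents (fun b => eqToIso (hFG b)) (fun φ => hom_ext (by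
    rw [comp_deg, comp_deg, Functor.id_map, Functor.comp_map, hFdeg, hGdeg, eqToIso.hom, eqToIso.hom,
      deg_eqToHom, deg_eqToHom, mul_one, one_mul]))
  let Ψ : Obj ≌ Obj := CategoryTheory.Equivalence.mk F G η ε
  refine ⟨Ψ, fun _ => rfl, fun _ _ _ => rfl, ?_, ?_⟩
  · -- right-hand isomorphism: co-angular pre-steps `0 → b` keep their zero divisor `b`
    intro b φ _
    have hb : 0 ≤ b.val := by
      have h := Hom.le φ
      have h0 : (Hom.deg φ : ℚ) * (⟨0⟩ : Obj).val = 0 := by show (Hom.deg φ : ℚ) * 0 = 0; ring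
      rwa [h0] at h
    show (zeroDiv (F.map φ) : ℚ) = zeroDiv φ
    rw [coe_zeroDiv, coe_zeroDiv, hFdeg, hFobj, hFobj, psiObj_val_of_nonneg hb, psiObj_zero]
  · -- left-hand isomorphism: co-angular pre-steps `a → 0` get their zero divisor `-a` multiplied by `λ`
    intro a ψ hψ
    have h1 : Hom.deg ψ = 1 := (isPreStep_iff ψ).mp hψ.2
    have ha : a.val ≤ 0 := by
      have h := Hom.le ψ
      rw [h1] at h
      have : ((1 : ℕ+) : ℚ) = 1 := by norm_num
      rw [this, one_mul] at h
      exact h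
    show (zeroDiv (F.map ψ) : ℚ) = l * zeroDiv ψ
    rw [coe_zeroDiv, coe_zeroDiv, hFdeg, h1, hFobj, hFobj, psiObj_zero]
    have h1' : ((1 : ℕ+) : ℚ) = 1 := by norm_num
    rw [h1', one_mul, one_mul]
    show (0 : ℚ) - (psiObj l a).val = l * (0 - a.val)
    rcases ha.lt_or_eq with hlt | heq
    · rw [psiObj_val_of_neg hlt]; ring
    · rw [psiObj_val_of_nonneg (le_of_eq heq.symm), heq]; ring

/-! ### Remark 4.9.1: the birationalization of `C` and (non-)rationality -/

/-- In `C` the co-angular pre-steps are exactly the arrows of Frobenius degree `1` (every arrow is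
co-angular and a base-isomorphism, p. 82). [cite: MochizukiFrdI2008, Ex. 4.3 p.82] -/
theorem isCoAngularPreStep_iff {a b : Obj} (φ : a ⟶ b) : data.IsCoAngularPreStep φ ↔ Hom.deg φ = 1 :=
  ⟨fun h => (isPreStep_iff φ).mp h.2, fun h => ⟨isCoAngular φ, (isPreStep_iff φ).mpr h⟩⟩

/-- The co-angular pre-steps of `C` admit a right calculus of fractions (Ore condition: shrink the
source below `min(X, Y/d)`; cancellation: arrows are determined by their degree) — so that
`Hom_{C^birat}(A, B) = lim_{A' → A} Hom_C(A', B)` (Prop. 4.4, p. 82) is the localisation of `C` at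
them. [cite: MochizukiFrdI2008, Ex. 4.3 p.82] -/
theorem hasRightCalculusOfFractions : data.IsCoAngularPreStep.HasRightCalculusOfFractions where
  id_mem a := (isCoAngularPreStep_iff _).mpr rfl
  comp_mem f g hf hg := (isCoAngularPreStep_iff _).mpr (by
    rw [comp_deg, (isCoAngularPreStep_iff f).mp hf, (isCoAngularPreStep_iff g).mp hg, one_mul])
  exists_rightFraction X Y φ := by
    -- `φ : X -f→ Y' ←s- Y` with `deg s = 1`; answer `X ←t- X'' -g→ Y`, `deg t = 1`, `deg g = deg f`
    have hd : (0 : ℚ) < (Hom.deg φ.f : ℚ) := by exact_mod_cast (Hom.deg φ.f).pos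
    let X'' : Obj := ⟨min X.val (Y.val / (Hom.deg φ.f : ℚ))⟩
    let t : X'' ⟶ X := ⟨1, by
      show ((1 : ℕ+) : ℚ) * min X.val (Y.val / (Hom.deg φ.f : ℚ)) ≤ X.val
      have : ((1 : ℕ+) : ℚ) = 1 := by norm_num
      rw [this, one_mul]; exact min_le_left _ _⟩
    let g : X'' ⟶ Y := ⟨Hom.deg φ.f, by
      show (Hom.deg φ.f : ℚ) * min X.val (Y.val / (Hom.deg φ.f : ℚ)) ≤ Y.val
      calc (Hom.deg φ.f : ℚ) * min X.val (Y.val / (Hom.deg φ.f : ℚ))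
          ≤ (Hom.deg φ.f : ℚ) * (Y.val / (Hom.deg φ.f : ℚ)) :=
            mul_le_mul_of_nonneg_left (min_le_right _ _) hd.le
        _ = Y.val := by field_simp⟩
    refine ⟨MorphismProperty.RightFraction.mk t ((isCoAngularPreStep_iff t).mpr rfl) g, hom_ext ?_⟩
    rw [comp_deg, comp_deg, (isCoAngularPreStep_iff φ.s).mp φ.hs]
    show (1 : ℕ+) * Hom.deg φ.f = Hom.deg φ.f * 1
    rw [one_mul, mul_one]
  ext X Y Y' f₁ f₂ s hs h := by
    refine ⟨X, 𝟙 X, (isCoAngularPreStep_iff _).mpr rfl, ?_⟩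
    have hdeg := congrArg Hom.deg h
    rw [comp_deg, comp_deg, (isCoAngularPreStep_iff s).mp hs, mul_one, mul_one] at hdeg
    rw [hom_ext hdeg]

/-- In the one-object category `B(N_{≥1})` every isomorphism is `1`. [cite: MochizukiFrdI2008, Ex. 4.3 p.82] -/
theorem singleObj_pnat_eq_one_of_isIso {x y : SingleObj ℕ+} (m : x ⟶ y) [IsIso m] : m = (1 : ℕ+) := by
  have h := IsIso.inv_hom_id m
  rw [SingleObj.comp_as_mul, SingleObj.id_as_one] at h
  have h' := congrArg PNat.val h
  rw [PNat.mul_coe, PNat.one_coe] at h'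
  exact PNat.coe_injective ((Nat.eq_one_of_mul_eq_one_right h').trans PNat.one_coe.symm)

/-- An arrow of `C` that becomes invertible in a localisation of `C` at the co-angular pre-steps has
Frobenius degree `1`: the Frobenius-degree functor `C → B(N_{≥1})` inverts the co-angular pre-steps,
so it factors through the localisation (Prop. 4.4 (i): "`C → C^birat` preserves Frobenius degrees").
[cite: MochizukiFrdI2008, Prop. 4.4 (i) p.83] -/
theorem deg_eq_one_of_isIso_map {E : Type*} [Category E] (L : Obj ⥤ E)
    [L.IsLocalization data.IsCoAngularPreStep] {X Y : Obj} (f : X ⟶ Y) [IsIso (L.map f)] :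
    Hom.deg f = 1 := by
  let degF : Obj ⥤ SingleObj ℕ+ :=
    { obj := fun _ => SingleObj.star ℕ+
      map := fun φ => Hom.deg φ
      map_id := fun _ => rfl
      map_comp := fun f g => by rw [SingleObj.comp_as_mul, comp_deg, mul_comm] }
  have hW : data.IsCoAngularPreStep.IsInvertedBy degF := fun X Y φ hφ => by
    have : degF.map φ = 𝟙 _ := by
      rw [SingleObj.id_as_one]; exact (isCoAngularPreStep_iff φ).mp hφ
    rw [this]; infer_instance
  let G := Localization.lift degF hW L
  let e : L ⋙ G ≅ degF := Localization.fac degF hW L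
  haveI : IsIso ((L ⋙ G).map f) := by
    change IsIso (G.map (L.map f)); infer_instance
  haveI : IsIso (degF.map f) := by
    rw [← NatIso.naturality_1 e f]; infer_instance
  exact singleObj_pnat_eq_one_of_isIso (degF.map f)

/-- "`O^×(A^birat) = {1}`" for the Frobenioid of Ex. 4.3: in any localisation `L` of `C` at the
co-angular pre-steps, every automorphism of `L(A)` is the identity (an automorphism is a right
fraction `A ← A' → A` whose numerator becomes invertible, hence has degree `1` and coincides with the
denominator). [cite: MochizukiFrdI2008, Rem. 4.9.1 p.90] -/
theorem aut_eq_one {E : Type*} [Category E] (L : Obj ⥤ E) [L.IsLocalization data.IsCoAngularPreStep]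
    (a : Obj) (u : Aut (L.obj a)) : u = 1 := by
  haveI := hasRightCalculusOfFractions
  obtain ⟨φ, hφ⟩ := Localization.exists_rightFraction L data.IsCoAngularPreStep u.hom
  have hs : Hom.deg φ.s = 1 := (isCoAngularPreStep_iff _).mp φ.hs
  have hcomp : L.map φ.s ≫ u.hom = L.map φ.f := by
    rw [hφ]; exact φ.map_s_comp_map L _
  haveI : IsIso (L.map φ.s) := Localization.inverts L data.IsCoAngularPreStep φ.s φ.hs
  haveI : IsIso (L.map φ.f) := by rw [← hcomp]; infer_instance
  have hf : Hom.deg φ.f = 1 := deg_eq_one_of_isIso_map L φ.f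
  have hfs : φ.f = φ.s := hom_ext (hf.trans hs.symm)
  apply Iso.ext
  show u.hom = 𝟙 _
  rw [← cancel_epi (L.map φ.s), hcomp, hfs, Category.comp_id]

/-- Positive rationals are primary elements of the monoid `ℚ_{≥0}` (archimedean property), so that
`Prime(ℚ_{≥0})` consists of exactly one prime. [cite: MochizukiFrdI2008, §0 p.12] -/
theorem isPrimary_ofAdd {q : NNRat} (hq : q ≠ 0) : IsPrimary (Multiplicative.ofAdd q) := by
  refine ⟨fun h => hq ?_, fun b hb _ => ?_⟩
  · have h' := congrArg Multiplicative.toAdd h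
    rwa [toAdd_ofAdd, toAdd_one] at h'
  · -- `ofAdd q ≼ b`: `q ≤ (n+1) • r` for `b = ofAdd r`, `r ≠ 0`
    have hr0 : Multiplicative.toAdd b ≠ 0 := by
      intro h
      apply hb
      have h' := congrArg Multiplicative.ofAdd h
      rwa [ofAdd_toAdd, ofAdd_zero] at h'
    have hrpos : 0 < Multiplicative.toAdd b := pos_iff_ne_zero.mpr hr0
    obtain ⟨n, hn⟩ := Archimedean.arch q hrpos
    have hle : q ≤ (n + 1) • Multiplicative.toAdd b :=
      hn.trans (by rw [succ_nsmul]; exact le_self_add)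
    refine ⟨n + 1, Nat.succ_pos n, Multiplicative.ofAdd ((n + 1) • Multiplicative.toAdd b - q), ?_⟩
    rw [← ofAdd_add, add_tsub_cancel_of_le hle, ofAdd_nsmul, ofAdd_toAdd]

/-- `Prime(ℚ_{≥0}) ≠ ∅` (the class of `1`). [cite: MochizukiFrdI2008, §0 p.12] -/
theorem nonempty_primes : Nonempty (Primes (Multiplicative NNRat)) :=
  ⟨Quotient.mk _ ⟨Multiplicative.ofAdd 1, isPrimary_ofAdd one_ne_zero⟩⟩

/-- **Remark 4.9.1**, content (PROVED): for a birationalization datum `B` of the Frobenioid `C` of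
Ex. 4.3 whose functor `C → C^birat` is a localisation at the co-angular pre-steps (the printed
inductive-limit definition of `Hom^birat`, Prop. 4.4 p. 82) and which satisfies the exactness of
Prop. 4.4 (iii) (`Φ^birat(A) = Im(O^×(A^birat))`), NO object of `C` is rational — for EVERY support
predicate `Supp`: `O^×(A^birat) = {1}` forces `Φ^birat ≡ 0`, so a "rational function" `a - b ∈ Φ^birat`
has `a = b` and cannot separate the (existing) prime of `ℚ_{≥0}` (p. 90: "One verifies immediately
that the Frobenioid of Example 4.3 is not of rational type"). [cite: MochizukiFrdI2008, Rem. 4.9.1 p.90] -/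
theorem not_isRational (B : data.BiratData) [B.toBirat.IsLocalization data.IsCoAngularPreStep]
    (h44 : PreFrobenioidData.Prop44iii B)
    (Supp : ∀ {X : D}, data.Mon X → Primes (data.Mon X) → Prop) (a : Obj) :
    ¬ PreFrobenioidData.IsRational B Supp a := by
  rintro ⟨a', φ, -, hsr⟩
  obtain ⟨𝔭⟩ := nonempty_primes
  obtain ⟨x, y, hmem, hx, hy⟩ := hsr 𝔭
  obtain ⟨u, hu⟩ := (h44 a').1 _ hmem
  have hu1 : u = 1 := Subtype.ext (aut_eq_one B.toBirat a' u.1)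
  rw [hu1, map_one, eq_comm, div_eq_one] at hu
  haveI : IsCancelMul (data.Mon (data.base.obj a')) := inferInstanceAs (IsCancelMul (Multiplicative NNRat))
  exact hy (Algebra.GrothendieckGroup.of_injective hu ▸ hx)

/-- **Remark 4.9.1** AS TYPED (`Ex43.Remark491 B Supp`; node `FrdI:Rmk4.9.1`), discharged for every
birationalization datum `B` whose `toBirat` is a localisation at the co-angular pre-steps and which
satisfies the typed Prop. 4.4 (iii), and for every support predicate `Supp`: the Frobenioid of Ex. 4.3
is not of rational type (p. 90). The schema is NOT closed for junk `B` (free `phiBirat`; see the module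
docstring, finding R491-F1). [cite: MochizukiFrdI2008, Rem. 4.9.1 p.90] -/
theorem remark491_of_isLocalization (B : data.BiratData)
    [B.toBirat.IsLocalization data.IsCoAngularPreStep] (h44 : PreFrobenioidData.Prop44iii B)
    (Supp : ∀ {X : D}, data.Mon X → Primes (data.Mon X) → Prop) : Remark491 B Supp :=
  ⟨⟨0⟩, not_isRational B h44 Supp ⟨0⟩⟩

end Ex43

end Literature.AlgebraicGeometry.Frobenioids
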